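import Mathlib.Analysis.Convex.SimplicialComplex.Basic
import Mathlib.Analysis.InnerProductSpace.PiL2
import Literature.Geometry.Riemannian.RiemannianDistance
import HarnessLib

/-!
# The cut locus of a point and the multiplicity of minimal geodesics (metric definitions); Buchner's triangulation theorem

Topic `Geometry/Riemannian`. Requested by route `SmoothPoincare4/CutLocusSpine` (definition item
`defn-cutLocus`; cite item Buchner 1977). For a Riemannian `PseudoRiemannianMetric g` on a manifold
`M` (`g.IsRiemannian`, with its Riemannian distance `d = g.edist hg` of
`Literature.Geometry.Riemannian.RiemannianDistance`) and a point `p ∈ M` we define, **purely in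
terms of the distance** (no exponential map, no geodesic ODE — the tree has geodesics only for an
abstract covariant derivative, `Literature.Geometry.Lorentzian.IsGeodesicOn`):

* `cutLocus g hg p = {q ≠ p | ∀ r, d(p,r) = d(p,q) + d(q,r) → r = q}` — the **cut locus** of `p`:
  the points `q ≠ p` which are interior points of *no* minimal segment issuing from `p` (no point
  `r ≠ q` lies "behind" `q` as seen from `p`). On a complete connected Riemannian manifold this is
  the classical cut locus `C(p)` = the set of cut points `γ_v(t_c(v))` along the unit-speed
  geodesics from `p` (Buchner 1977 p. 118: "the first point `γ(t₀)` such that for `t > t₀`, `γ` no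
  longer minimizes arclength", and its standard characterisation "`x` is the first conjugate point
  on a length minimizing geodesic starting at `p` and going through `x`, or there are at least two
  length minimizing geodesics from `p` to `x`"): a point `q ≠ p` lies in the interior of a minimal
  segment from `p` iff the minimal geodesic from `p` to `q` is unique and extends minimally beyond
  `q`, i.e. iff `q` is neither `p` nor a cut point (Chavel 2006, III.4; Sakai, *Riemannian
  geometry*, III §4). We take the metric description as the DEFINITION; the equality with the
  classical `C(p)` for complete metrics is a theorem NOT vendored here.
* `minimalGeodesicMultiplicity g hg p q ∈ ℕ∞` — the number (`Set.encard`) of **midpoints** of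
  `p` and `q`: points `m` with `d(p,m) = d(m,q)` and `d(p,m) + d(m,q) = d(p,q)`. On a complete
  connected Riemannian manifold, `m ↦` (minimal segment `p → m`) ∗ (minimal segment `m → q`) is a
  bijection from midpoints onto the minimal geodesics from `p` to `q` (a curve through a midpoint
  realising the distance is an unbroken minimal geodesic, and two distinct minimal geodesics
  from `p` to `q` cannot share their midpoint, since past a point reached by two minimal segments
  from `p` no segment from `p` minimises), so this is the multiplicity of `q` as seen from `p`;
  Bishop 1977 (main theorem): `C(p)` is the closure of `{q | multiplicity ≥ 2}` — NOT vendored.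
* API (proved): `mem_cutLocus_iff`, `not_mem_cutLocus_self`, `minimalGeodesicMultiplicity_comm`,
  `minimalGeodesicMultiplicity_self` (`= 1` on `T₃` manifolds).
* ONE named fact: `buchner1977_cutLocus_triangulable` — **Buchner 1977**: on a compact
  real-analytic Riemannian manifold the cut locus of any point is homeomorphic to (the polyhedron
  of) a finite simplicial complex of dimension `≤ n - 1` (as printed: `C(p)` is subanalytic, hence
  triangulable by Hironaka; this establishes Myers' conjecture "the locus in the analytic
  `n`-dimensional case is homeomorphic to a finite `(n-1)`-dimensional complex", p. 118).

Design. The definitions are stated for any `C^n` metric on any manifold on which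
`RiemannianDistance` makes sense; the intended range is complete (e.g. compact) connected
Riemannian manifolds, where they agree with the classical notions — on incomplete or disconnected
manifolds they are the literal metric sets above (documented junk: e.g. for `q` in another
path component `d(p,q) = ∞` and `q ∉ cutLocus`). Buchner's fact is stated for compact connected
Hausdorff boundaryless (`I.Boundaryless`) real-analytic (`IsManifold I ω`, metric of class `C^ω`)
manifolds, dimension `n = finrank ℝ E`, with the complex realised in a Euclidean space
(Mathlib `Geometry.SimplicialComplex ℝ (EuclideanSpace ℝ (Fin N))`, finitely many faces, each of
`≤ n` vertices). Mathlib/tree searches: no `cutLocus`, no injectivity/conjugate radius, no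
exponential map of a Riemannian metric (`lean search 'utLocus|cut locus|Buchner'`: nothing).

## References

* M. A. Buchner, *Simplicial structure of the real analytic cut locus*, Proc. AMS 64 (1977)
  118–121 (abstract; p. 118 definitions; p. 121 conclusion) [Buchner1977Simplicial].
* R. L. Bishop, *Decomposition of cut loci*, Proc. AMS 65 (1977) 133–136 [Bishop1977].
* I. Chavel, *Riemannian geometry: a modern introduction*, 2nd ed. (2006), §III.4 [Chavel2006].
-/

noncomputable section

open Set Manifold
open scoped Manifold ContDiff Topology ENNReal

namespace Literature.Geometry.Riemannian

open Literature.Geometry.Lorentzian (PseudoRiemannianMetric)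

section Definitions

variable {E : Type*} [NormedAddCommGroup E] [NormedSpace ℝ E] {H : Type*} [TopologicalSpace H]
  {I : ModelWithCorners ℝ E H} {M : Type*} [TopologicalSpace M] [ChartedSpace H M]
  [IsManifold I ∞ M] {n : ℕ∞ω} [FiniteDimensional ℝ E]
  (g : PseudoRiemannianMetric I n E (TangentSpace I : M → Type _))

/-- The **cut locus** of `p` for the Riemannian metric `g` (metric form): the set of points
`q ≠ p` such that no minimal segment from `p` extends beyond `q`, i.e. whenever
`d(p, r) = d(p, q) + d(q, r)` (`r` lies behind `q` as seen from `p`) then `r = q`. On a complete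
connected Riemannian manifold this is the classical cut locus `C(p)` of cut points along the
geodesics from `p` (Buchner 1977, p. 118; Chavel 2006, III.4); see the module docstring. [cite: Buchner1977Simplicial, p. 118 (definition of C(p))] -/
def cutLocus (hg : g.IsRiemannian) (p : M) : Set M :=
  {q | q ≠ p ∧ ∀ r, g.edist hg p r = g.edist hg p q + g.edist hg q r → r = q}

/-- The **multiplicity of minimal geodesics** from `p` to `q` (metric form): the number of
midpoints of `p` and `q`, i.e. of points `m` with `d(p, m) = d(m, q)` and
`d(p, m) + d(m, q) = d(p, q)`, as an extended natural number (`Set.encard`; `⊤` if infinite). On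
a complete connected Riemannian manifold midpoints correspond bijectively to minimal geodesics
from `p` to `q`; Bishop 1977: the cut locus is the closure of the points of multiplicity `≥ 2`
(Bishop 1977, main theorem; Buchner 1977, p. 118: "there are at least two length minimizing
geodesics from `p` to `x`"). The midpoint description is the standard metric one. [folklore] -/
def minimalGeodesicMultiplicity (hg : g.IsRiemannian) (p q : M) : ℕ∞ :=
  {m | g.edist hg p m = g.edist hg m q ∧ g.edist hg p m + g.edist hg m q = g.edist hg p q}.encard

variable {g}

/-- Membership in the cut locus (definitional). [folklore] -/
theorem mem_cutLocus_iff (hg : g.IsRiemannian) {p q : M} :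
    q ∈ cutLocus g hg p ↔ q ≠ p ∧ ∀ r, g.edist hg p r = g.edist hg p q + g.edist hg q r → r = q :=
  Iff.rfl

/-- The base point is not in its own cut locus. [folklore] -/
theorem not_mem_cutLocus_self (hg : g.IsRiemannian) (p : M) : p ∉ cutLocus g hg p :=
  fun h => h.1 rfl

/-- The set of midpoints, unfolded (definitional). [folklore] -/
theorem minimalGeodesicMultiplicity_eq_encard (hg : g.IsRiemannian) (p q : M) :
    minimalGeodesicMultiplicity g hg p q =
      {m | g.edist hg p m = g.edist hg m q ∧
        g.edist hg p m + g.edist hg m q = g.edist hg p q}.encard := rfl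

/-- The multiplicity is symmetric in `p` and `q` (midpoints of `p, q` and of `q, p` coincide). [folklore] -/
theorem minimalGeodesicMultiplicity_comm (hg : g.IsRiemannian) (p q : M) :
    minimalGeodesicMultiplicity g hg p q = minimalGeodesicMultiplicity g hg q p := by
  simp only [minimalGeodesicMultiplicity_eq_encard]
  congr 1
  ext m
  simp only [mem_setOf_eq]
  rw [g.edist_comm hg q m, g.edist_comm hg m p, g.edist_comm hg q p]
  constructor
  · rintro ⟨h1, h2⟩
    exact ⟨h1.symm, by rw [add_comm]; exact h2⟩
  · rintro ⟨h1, h2⟩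
    exact ⟨h1.symm, by rw [add_comm]; exact h2⟩

/-- A point has multiplicity one as seen from itself: the only midpoint of `p, p` is `p`
(definiteness of the distance, on `T₃` manifolds). [folklore] -/
theorem minimalGeodesicMultiplicity_self [T3Space M] (hg : g.IsRiemannian) (p : M) :
    minimalGeodesicMultiplicity g hg p p = 1 := by
  rw [minimalGeodesicMultiplicity_eq_encard]
  have : {m | g.edist hg p m = g.edist hg m p ∧
      g.edist hg p m + g.edist hg m p = g.edist hg p p} = {p} := by
    ext m
    simp only [mem_setOf_eq, mem_singleton_iff, g.edist_self hg, add_eq_zero,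
      g.edist_eq_zero_iff hg]
    constructor
    · rintro ⟨-, h, -⟩
      exact h.symm
    · rintro rfl
      exact ⟨rfl, rfl, rfl⟩
  rw [this, encard_singleton]

end Definitions

/-! ### Buchner 1977: triangulability of the real-analytic cut locus -/

/-- **Buchner 1977** (Proc. AMS 64, 118–121; abstract and p. 118: Myers' conjecture "the locus in
the analytic `n`-dimensional case is homeomorphic to a finite `(n-1)`-dimensional complex … The
argument that follows will establish this conjecture"; p. 121: "the cut locus itself is
subanalytic", triangulable by Hironaka). Let `M` be a compact connected Hausdorff real-analytic
manifold without boundary of dimension `n = finrank ℝ E`, with a real-analytic Riemannian metric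
`g`, and `p ∈ M`. Then the cut locus of `p` is homeomorphic to the polyhedron of a finite
simplicial complex of dimension `≤ n - 1` (every face has at most `n` vertices), realised in some
Euclidean space. Stated for the metric `cutLocus`, which on compact (complete) connected manifolds
is Buchner's `C(p)`. [cite: Buchner1977Simplicial, Theorem (abstract, pp. 118 and 121)] -/
def buchner1977_cutLocus_triangulable : Prop :=
  ∀ {E : Type*} [NormedAddCommGroup E] [NormedSpace ℝ E] [FiniteDimensional ℝ E]
    {H : Type*} [TopologicalSpace H] (I : ModelWithCorners ℝ E H) [I.Boundaryless]
    {M : Type*} [TopologicalSpace M] [ChartedSpace H M] [IsManifold I ω M]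
    [CompactSpace M] [T2Space M] [ConnectedSpace M]
    (g : PseudoRiemannianMetric I ω E (TangentSpace I : M → Type _)) (hg : g.IsRiemannian) (p : M),
    ∃ (N : ℕ) (K : Geometry.SimplicialComplex ℝ (EuclideanSpace ℝ (Fin N))),
      K.faces.Finite ∧ (∀ s ∈ K.faces, s.card ≤ Module.finrank ℝ E) ∧
        Nonempty (cutLocus g hg p ≃ₜ K.space)

end Literature.Geometry.Riemannian
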